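import Summits.ResolutionOfSingularities.ResolutionOfSingularities.Theorems.PurelyInseparableDim4NarrowDrop
import HarnessLib

/-!
# (N1) along a chain — «(H) HOLDS ON THE NARROW FLOOR»: an all-narrow isolated floor chain from `c₀`
has at most `μ⁺(c₀) − 1` edges (cell `res-dim4-pi`)

[OURS · counted 0 · corollaries of the (N1⁺) edge law `RidgeBudget.jetColength_step_succ_le`
(`…NarrowDrop`, p662631); nothing here is a statement of any manuscript and nothing here proves
`NoWideTrap`, `NoIsolatedTrap 3 3` or resolution of singularities in dimension ≥ 4 / characteristic `p`.]

idea-3's budget law (H) `RidgeBudget.HeightBudget p q` («an isolated chain `c₀ → ⋯ → c_m` has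
`m + 1 ≤ μ⁺(c₀)`») is FALSE at `(3,3)` (crit-4 V-A4-10 / crit-1 K-A-14 / crit-3 AUDIT-A3-03: a wide
non-drop edge followed by a tight narrow staircase overdraws it).  This file proves the part of (H)
that IS true, for every prime `p`: along a `Step0` chain whose states all lie on the floor
(`ord₀ = p`) and whose edges all start at NARROW states (`ē = 1`), the colength staircase is tight —
`μ⁺(c_k) + k ≤ μ⁺(c₀)` at every level — so the chain has at most `μ⁺(c₀) − 1` edges
(crit-4's corollary of V-A4-09, idea-3's N1-PROOF-v2 Cor. (1); the staircases `μ, μ−1, …, 1` of the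
census show the bound is attained).

* `jetColength_le_of_isCert` (`μ⁺` read below a certificate level is `≤ μ⁺`), `not_isCert_zero`,
  `one_le_jetColength`;
* **`jetColength_chain_add_le`** — the staircase: certificate at `c₀`, floor + narrow at `c_k (k < m)` ⇒
  every `c_k (k ≤ m)` is certified and `jetColength p N' (c k).F + k ≤ μ⁺(c₀)` for all `N'`;
* **`narrow_chain_succ_le_jetColength`** — `m + 1 ≤ μ⁺(c₀)` («(H) on the narrow floor»);
* **`no_narrow_floor_trap`** — no infinite `Step0` chain of floor states with `ē = 1` throughout from a
  certified state (the narrow third of idea-3's ridge trichotomy, now by (N1) rather than by the cone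
  theorem FT(p,p) of p-12 g2's `RidgeResidual`).

bears_on: LADDER-RESOLUTION:D157-DOOR2 (res-dim4-pi · F4-I(p,p) narrow branch · (N1) corollaries).  Seat
res-dim4-p-1 g2.  Supports stmt-ResolutionOfSingularities-16155 (helper).
-/

set_option linter.dupNamespace false

noncomputable section

namespace Summit.ResolutionOfSingularities.ResolutionOfSingularities.Theorems.PIDim4

namespace RidgeBudget

open MvPolynomial Finset
open Literature.AlgebraicGeometry.Resolution
open Literature.AlgebraicGeometry.Resolution.Hauser2010
open Literature.AlgebraicGeometry.Resolution.HauserPerlega2019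

variable {K : Type} [Field K]

/-! ## 1. Reading `μ⁺` at and below a certificate level -/

/-- Below (or above) a certificate level the jet colength never exceeds `μ⁺`: `IsCert q N F ⇒
jetColength q N' F ≤ jetColength q N F` for every `N'`. [OURS · bookkeeping] [folklore] -/
theorem jetColength_le_of_isCert {q N : ℕ} {F : MvPolynomial (Fin 4) K} (hN : IsCert q N F)
    (N' : ℕ) : jetColength q N' F ≤ jetColength q N F := by
  rcases le_total N N' with h | h
  · exact (jetColength_eq_of_isCert hN h).le
  · exact IsolationCert.finrank_quotient_le_of_le (n := N) le_sup_right
      (sup_le_sup_left (Ideal.pow_le_pow_right h) _)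

/-- Level `0` is never a certificate level when `J_q⁺(F) ≤ 𝔪₀` (`𝔪₀⁰ = R ≰ 𝔪₀`). [OURS · bookkeeping]
[folklore] -/
theorem not_isCert_zero {q : ℕ} {F : MvPolynomial (Fin 4) K}
    (hJ : singLocusIdeal q F ≤ originIdeal K) : ¬ IsCert q 0 F := by
  intro h
  have htop : (⊤ : Ideal (MvPolynomial (Fin 4) K)) ≤ originIdeal K := by
    have : originIdeal K ^ 0 ≤ singLocusIdeal q F ⊔ originIdeal K ^ (0 + 1) := h
    rw [pow_zero, Ideal.one_eq_top, zero_add, pow_one] at this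
    exact this.trans (sup_le hJ le_rfl)
  exact IsolationCert.originIdeal_ne_top K (top_le_iff.mp htop)

/-- **`μ⁺ ≥ 1`** at a certificate level when `J_q⁺(F) ≤ 𝔪₀`. [OURS · bookkeeping] [folklore] -/
theorem one_le_jetColength {q N : ℕ} {F : MvPolynomial (Fin 4) K}
    (hJ : singLocusIdeal q F ≤ originIdeal K) (hN : IsCert q N F) : 1 ≤ jetColength q N F :=
  IsolationCert.le_finrank_of_forall_not_certificate_of_certificate
    (fun k hk => by
      have hk0 : k = 0 := by omega
      subst hk0
      exact not_isCert_zero hJ) hN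

/-! ## 2. The staircase along an all-narrow floor chain -/

/-- **THE NARROW STAIRCASE.**  Let `c 0 → c 1 → ⋯ → c m` be a `Step0` chain (`p` prime) whose states
`c k`, `k < m`, have order exactly `p` and one-dimensional ridge (`ē = 1`), and let `c 0` carry an
isolation certificate at level `N`.  Then every `c k`, `k ≤ m`, carries a certificate, and
`jetColength p N' (c k).F + k ≤ μ⁺(c 0)` at every level `N'`.  (Induction on (N1⁺)
`jetColength_step_succ_le`; the certificates propagate by `isIsolated_step_of_ebar_eq_one`.)
[OURS · (N1) corollary] [cite: CossartJannsenSaito2020, Cor. 6.37 (qualitative prior art)] -/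
theorem jetColength_chain_add_le (p : ℕ) [Fact p.Prime] [CharP K p] [DecidableEq K]
    (c : ℕ → State K) (m : ℕ) (hstep : ∀ k, k < m → Step0 p (c k) (c (k + 1)))
    (hord : ∀ k, k < m → ordZero (c k).F = p) (he : ∀ k, k < m → ebar (c k).F = 1)
    {N : ℕ} (hN : IsCert p N (c 0).F) :
    ∀ k, k ≤ m → (∃ Nk, IsCert p Nk (c k).F) ∧
      ∀ N' : ℕ, jetColength p N' (c k).F + k ≤ jetColength p N (c 0).F := by
  intro k
  induction k with
  | zero =>
    intro _
    exact ⟨⟨N, hN⟩, fun N' => by simpa using jetColength_le_of_isCert hN N'⟩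
  | succ k ih =>
    intro hk
    obtain ⟨⟨Nk, hNk⟩, hbound⟩ := ih (Nat.le_of_succ_le hk)
    have hkm : k < m := Nat.lt_of_succ_le hk
    obtain ⟨-, j, b, -, hbj, heq, -, hck⟩ := hstep k hkm
    refine ⟨?_, fun N' => ?_⟩
    · rw [hck]
      exact exists_isCert_of_isIsolated
        (isIsolated_step_of_ebar_eq_one p (hord k hkm) (he k hkm) hNk hbj heq)
    · have h1 := jetColength_step_succ_le p (hord k hkm) (he k hkm) hNk hbj heq N'
      rw [← hck] at h1
      have h2 := hbound Nk
      omega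

/-- **«(H) HOLDS ON THE NARROW FLOOR»**: an all-narrow floor `Step0` chain `c 0 → ⋯ → c m` (order `p`
and `ē = 1` at every `c k`, `k < m`; order `p` also at `c m`) from a state certified at level `N` has
`m + 1 ≤ μ⁺(c 0) = jetColength p N (c 0).F`: at most `μ⁺(c₀) − 1` edges (crit-4 V-A4-09 corollary; the
bound is attained by the census staircases `μ, μ−1, …, 1`).  Contrast: the unrestricted budget law
`HeightBudget 3 3` is false (crit-4 V-A4-10). [OURS · (N1) corollary]
[cite: CossartJannsenSaito2020, Cor. 6.37 (qualitative prior art)] -/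
theorem narrow_chain_succ_le_jetColength (p : ℕ) [Fact p.Prime] [CharP K p] [DecidableEq K]
    (c : ℕ → State K) (m : ℕ) (hstep : ∀ k, k < m → Step0 p (c k) (c (k + 1)))
    (hord : ∀ k, k ≤ m → ordZero (c k).F = p) (he : ∀ k, k < m → ebar (c k).F = 1)
    {N : ℕ} (hN : IsCert p N (c 0).F) : m + 1 ≤ jetColength p N (c 0).F := by
  obtain ⟨⟨Nm, hNm⟩, hbound⟩ := jetColength_chain_add_le p c m hstep
    (fun k hk => hord k hk.le) he hN m le_rfl
  have h1 : 1 ≤ jetColength p Nm (c m).F :=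
    one_le_jetColength (singLocusIdeal_le_originIdeal_of_ordZero_eq (hord m le_rfl)) hNm
  have h2 := hbound Nm
  omega

/-- The same with «isolated» in place of «certified» at `c 0`. [OURS · (N1) corollary]
[cite: CossartJannsenSaito2020, Cor. 6.37 (qualitative prior art)] -/
theorem narrow_chain_length_lt_of_isIsolated (p : ℕ) [Fact p.Prime] [CharP K p] [DecidableEq K]
    (c : ℕ → State K) (m : ℕ) (hstep : ∀ k, k < m → Step0 p (c k) (c (k + 1)))
    (hord : ∀ k, k ≤ m → ordZero (c k).F = p) (he : ∀ k, k < m → ebar (c k).F = 1)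
    (hiso : IsIsolated p (c 0).F) : ∃ N, IsCert p N (c 0).F ∧ m < jetColength p N (c 0).F := by
  obtain ⟨N, hN⟩ := exists_isCert_of_isIsolated hiso
  exact ⟨N, hN, narrow_chain_succ_le_jetColength p c m hstep hord he hN⟩

/-! ## 3. No narrow floor trap -/

/-- **No infinite all-narrow isolated floor chain**: there is no infinite `Step0` chain whose states
all have order `p` and `ē = 1`, starting from a `J_p⁺`-isolated state — the narrow third of idea-3's
ridge trichotomy, here by the colength staircase (N1) (p-12 g2's `RidgeResidual` reaches it through
the cone theorem FT(p,p)). [OURS · (N1) corollary]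
[cite: CossartJannsenSaito2020, Cor. 6.37 (qualitative prior art)] -/
theorem no_narrow_floor_trap (p : ℕ) [Fact p.Prime] (K : Type) [Field K] [CharP K p]
    [DecidableEq K] :
    ¬ ∃ c : ℕ → State K, IsIsolated p (c 0).F ∧
      ∀ k, Step0 p (c k) (c (k + 1)) ∧ ordZero (c k).F = p ∧ ebar (c k).F = 1 := by
  rintro ⟨c, hiso, hc⟩
  obtain ⟨N, hN⟩ := exists_isCert_of_isIsolated hiso
  have h := narrow_chain_succ_le_jetColength p c (jetColength p N (c 0).F)
    (fun k _ => (hc k).1) (fun k _ => (hc k).2.1) (fun k _ => (hc k).2.2) hN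
  omega

end RidgeBudget

end Summit.ResolutionOfSingularities.ResolutionOfSingularities.Theorems.PIDim4

end
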